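import Summits.BirchSwinnertonDyer.BirchSwinnertonDyer.Theorems.LeafSigmaStarDivisibilityAtThreeOptimalOffRows.Negative.IndexThreshold
import Summits.BirchSwinnertonDyer.Rank1Residual.X11b.RingClassFieldNoTorsionOfIrreducible
import Summits.BirchSwinnertonDyer.Rank1Residual.X11b.SplitPrimeUnramified
import HarnessLib

/-!
# Σ★″ (`LeafSigmaStarDivisibilityAtThreeOptimalOffRows`, item 27493) — NEGATIVE lemmas, companion of
# `IndexThreshold.lean`: (A) the threshold and the refuted strengthening on IRREDUCIBLE rows (98 non-onto leaf
# classes); (B) ROW-WISE SHARPNESS of the budget under BSD₃-pair + McCallum Cor. 5.6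
# (standing disprover cdisprove-27493 g0; `--supports stmt-BirchSwinnertonDyer-27493`; BSD is proved or disproved for no curve)

(A) Σ★″ carries NO image binder; all its rows are nevertheless `ρ̄₃`-IRREDUCIBLE (`Addv W 3 ∧ SubGss W 3`:
`E` is a ramified quadratic twist of a curve `E₀/ℚ` with good SUPERSINGULAR reduction at `3`, whose
`ρ̄₃|I₃` is a non-split Cartan of order `8`, Serre 1972 §1.11 Prop. 12), so `E(K)[3] = 0`, and `E(K[1])`
has no `3`-power torsion by Gross 4.3 / McCallum §4 (5) on the irreducible cell (Weil pairing named, `3`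
unramified in `K` from the Heegner hypothesis at `3 ∣ N`):
* `pDiv_one_iff_le_padicValNat_index_of_irreducible` — `PDiv d₁ 3 s' ↔ s' ≤ ord₃ [E(K):ℤP]`;
* `not_pDiv_one_succ_of_padicValNat_index_le_of_irreducible` — `ord₃ [E(K):ℤP] ≤ B ⟹ ¬ PDiv d₁ 3 (B+1)`;
* `leafSigmaStar_budget_succ_false_of_irreducible_frame_index_le` — Σ★″ with budget `+ 1` (text otherwise
  VERBATIM) is FALSE given one irreducible Σ★″-frame with `ord₃ [E(K):ℤP] ≤ ord₃ ∏c_ℓ + v₃|c|`.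
(B) `budget_succ_false_at_row_of_bsdp_pair_of_h56` — under `BSD₃(E) ∧ BSD₃(E^{d_K})` and McCallum's
Cor. 5.6 at the datum (`h56`, the labelled hypothesis of the tree's `indexLowerBoundAt_of_kolyvaginCertificate`)
the row's «budget + 1» conclusion is FALSE on EVERY onto row, whatever `Ш(E/K)[3^∞]`: the `n = 1`
certificate gives `M_∞ ≤ M₀ < ∞`, «budget + 1» forces `M_∞ ≥ budget + 1`, `h56` + the two BSD₃'s force
`M_∞ = budget`. With `RamifiedHeegnerPairLeafSigmaStarTightData` (Σ★″ ⟸ BSD₃-pair + print) this pins the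
threshold `M_∞ = ord₃∏c_ℓ + v₃|c|` exactly: Σ★″ is SHARP on every row.
Theorems only — no definition, no named fact, no `sorry`; CONDITIONAL on the displayed named facts.
References: [McCallumLMS1991] §5 Lemma 5.1, Thm. 5.4, Cor. 5.6, §4 (5); [GrossLMS1991] Lemma 4.3;
[GrossZagier1986] V.(2.2); [Serre1972] §1.11 Prop. 12.
-/

-- D-0017: single-problem summit, so `Summit.BirchSwinnertonDyer.BirchSwinnertonDyer.…` repeats a namespace BY DESIGN.
set_option linter.dupNamespace false
set_option autoImplicit false

noncomputable section

open scoped Classical NumberField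

open WeierstrassCurve NumberField IsDedekindDomain Literature Literature.NumberTheory.EllipticCurves
  Literature.NumberTheory.EllipticCurves.ModularForms
  Literature.NumberTheory.EllipticCurves.Rank1Residual
  Literature.NumberTheory.EllipticCurves.Rank1Residual.Typed
  Summit.BirchSwinnertonDyer.Rank1Residual
  Summit.BirchSwinnertonDyer.Rank1Residual.Additive
  Summit.BirchSwinnertonDyer.Rank1Residual.X11b
  Summit.BirchSwinnertonDyer.BirchSwinnertonDyer.Theses.RamifiedHeegnerPair
  Summit.BirchSwinnertonDyer.BirchSwinnertonDyer.Theorems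

namespace Summit.BirchSwinnertonDyer.BirchSwinnertonDyer.Theorems.LeafSigmaStarDivisibilityAtThreeOptimalOffRowsNegative

section Irreducible

variable {N : ℕ} [NeZero N] {W : WeierstrassCurve ℚ} [W.IsElliptic] {K : Type} [Field K] [NumberField K]
  {Dt : ModularParametrizationData W N} {β : ℤ} {ι : K →+* ℂ}

/-- **McCallum's Lemma 5.1 at `n = 1`, index form, on an IRREDUCIBLE row (all Σ★″ rows: `SubGss`
makes `E` a ramified quadratic twist of a good-supersingular-at-`3` curve, whose `ρ̄₃` is irreducible
already on inertia — Serre 1972 Prop. 12; the 98 non-onto leaf classes are normaliser-of-non-split-Cartan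
rows).** `E(K)[3] = 0` from irreducibility
(`torsionBy_eq_bot_of_isImaginaryQuadratic_of_hasIrreducibleModPGaloisRep`); no `3`-power torsion in
`E(K[1])` from irreducibility + the Weil pairing (`hW`, named) + `3` unramified in `K`, which the Heegner
hypothesis at `3 ∣ N` gives (`3` splits: `isUnramifiedIn_of_ncard_primesOver_eq_two`) — tree
`torsionBy_pow_ringClassField_eq_bot_of_hasIrreducibleModPGaloisRep`. Then
`PDiv d₁ 3 s' ↔ s' ≤ ord₃ [E(K):ℤP]`. [cite: McCallumLMS1991, §5 Lemma 5.1 (p. 303), §4 (5)]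
[cite: GrossLMS1991, Lemma 4.3] [cite: Serre1972, §1.11 Prop. 12] -/
theorem pDiv_one_iff_le_padicValNat_index_of_irreducible (hK : IsImaginaryQuadratic K)
    (hHN : SatisfiesHeegnerHypothesis N K) (h3N : 3 ∣ N) (hirr : W.HasIrreducibleModPGaloisRep 3)
    (hW : W.exists_weilPairing 3) (hrank : (W.baseChange K).mordellWeilRank = 1)
    (d₁ : KolyvaginHeegnerData Dt β ι 1) (P : (W.baseChange K).toAffine.Point)
    (hP1 : WeierstrassCurve.Affine.Point.map (W' := W) (algebraMap K (ringClassField K ι 1)).toRatAlgHom P =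
      d₁.derivedPoint)
    (hPinf : ¬ IsOfFinAddOrder P) (s' : ℕ) :
    Three.Koly.PDiv d₁ 3 s' ↔ s' ≤ padicValNat 3 (AddSubgroup.zmultiples P).index := by
  haveI : Fact (Nat.Prime 3) := ⟨Nat.prime_three⟩
  have hp2 : (3 : ℕ) ≠ 2 := by decide
  -- `E(K)[3] = 0`
  have hbot := torsionBy_eq_bot_of_isImaginaryQuadratic_of_hasIrreducibleModPGaloisRep W K hK Nat.prime_three hirr
  have hiv : ∀ x : (W.baseChange K).toAffine.Point, (3 : ℕ) • x = 0 → x = 0 := fun x hx ↦ by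
    have hmem : x ∈ AddSubgroup.torsionBy (W.baseChange K).toAffine.Point (((3 : ℕ) : ℕ) : ℤ) := by
      rw [mem_torsionBy_iff, natCast_zsmul]
      exact hx
    rw [hbot] at hmem
    exact hmem
  -- `3` unramified in `K` (it splits, Heegner hypothesis at `3 ∣ N`)
  have hKunr : ∀ v : HeightOneSpectrum (𝓞 ℚ), ((3 : ℕ) : 𝓞 ℚ) ∈ v.asIdeal →
      Algebra.IsUnramifiedIn (𝓞 K) v.asIdeal :=
    isUnramifiedIn_of_ncard_primesOver_eq_two hK.1 Nat.prime_three (hHN 3 Nat.prime_three h3N)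
  -- no `3^M`-torsion in `E(K[1])`
  have htor : ∀ (M : ℕ) (R : (W.baseChange (ringClassField K ι 1)).toAffine.Point),
      ((3 ^ M : ℕ) : ℤ) • R = 0 → R = 0 := fun M R hR ↦ by
    have hmem : R ∈ AddSubgroup.torsionBy (W.baseChange (ringClassField K ι 1)).toAffine.Point ((3 ^ M : ℕ) : ℤ) := by
      rw [mem_torsionBy_iff]
      exact hR
    rw [NoTorsionIrr.torsionBy_pow_ringClassField_eq_bot_of_hasIrreducibleModPGaloisRep W hK ι one_ne_zero Nat.prime_three hp2
      hirr hW hKunr (by decide) M] at hmem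
    exact hmem
  exact pDiv_one_iff_le_padicValNat_index_of_noTorsion hK hiv htor hrank d₁ P hP1 hPinf s'

/-- **Strengthening by one fails at `n = 1` on an IRREDUCIBLE row, modulo the per-row index hypothesis**
(`ord₃ [E(K):ℤP] ≤ B ⟹ ¬ 3^{B+1} ∣ P_1`). [cite: McCallumLMS1991, §5 Lemma 5.1 (p. 303)] -/
theorem not_pDiv_one_succ_of_padicValNat_index_le_of_irreducible (hK : IsImaginaryQuadratic K)
    (hHN : SatisfiesHeegnerHypothesis N K) (h3N : 3 ∣ N) (hirr : W.HasIrreducibleModPGaloisRep 3)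
    (hW : W.exists_weilPairing 3) (hrank : (W.baseChange K).mordellWeilRank = 1)
    (d₁ : KolyvaginHeegnerData Dt β ι 1) (P : (W.baseChange K).toAffine.Point)
    (hP1 : WeierstrassCurve.Affine.Point.map (W' := W) (algebraMap K (ringClassField K ι 1)).toRatAlgHom P =
      d₁.derivedPoint)
    (hPinf : ¬ IsOfFinAddOrder P) {B : ℕ} (hidx : padicValNat 3 (AddSubgroup.zmultiples P).index ≤ B) :
    ¬ Three.Koly.PDiv d₁ 3 (B + 1) := by
  rw [pDiv_one_iff_le_padicValNat_index_of_irreducible hK hHN h3N hirr hW hrank d₁ P hP1 hPinf]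
  omega

/-- **Refuted strengthening on IRREDUCIBLE rows (modulo the per-row index hypothesis): Σ★″ with budget
`+ 1` is FALSE** as soon as ONE Σ★″-frame with `ρ̄_{E,3}` irreducible (all leaf rows, Serre Prop. 12),
the Weil pairing (`exists_weilPairing 3`, named) and `3 ∣ N` has `ord₃ [E(K):ℤP] ≤ ord₃ ∏c_ℓ(E) + v₃|c|`.
The negated statement is the registered text with `padicValNat 3 Dt.c.natAbs` replaced by
`padicValNat 3 Dt.c.natAbs + 1`, everything else VERBATIM. CONDITIONAL on `hrec`, `hKo`, `h36`, `hF`;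
BSD is proved or disproved for no curve. [cite: McCallumLMS1991, §5 Lemma 5.1 (p. 303), §4 (5)]
[cite: GrossLMS1991, Lemma 4.3] -/
theorem leafSigmaStar_budget_succ_false_of_irreducible_frame_index_le
    (hrec : ∀ (N : ℕ) [NeZero N] (W : WeierstrassCurve ℚ) (K : Type) [Field K] [NumberField K],
      heegnerPointOfConductor_one_galoisConj N W K)
    (hKo : ∀ (N : ℕ) [NeZero N] (W : WeierstrassCurve ℚ) (K : Type) [Field K] [NumberField K],
      kolyvagin N W K)
    (h36 : ∀ (N : ℕ) [NeZero N] (W : WeierstrassCurve ℚ) (K : Type) [Field K] [NumberField K],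
      phi_heegnerTau_mem_range_map_singularModuliField N W K)
    (hF : ∃ (W : WeierstrassCurve ℚ) (_ : W.IsElliptic) (_ : W.IsGloballyMinimal) (N : ℕ) (_ : NeZero N) (K : Type)
      (_ : Field K) (_ : NumberField K) (Dt : ModularParametrizationData W N) (H : HeegnerDatum N (NumberField.discr K))
      (ι : K →+* ℂ) (P : (W.baseChange K).toAffine.Point),
      ¬ W.HasCM ∧ Addv W 3 ∧ SubGss W 3 ∧ W.conductorNorm ℤ = N ∧
      (∀ z ∈ Dt.L.lattice, ∃ w ∈ periodLattice Dt.f, z = Dt.c * w) ∧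
      ¬ ((∃ (q : ℕ) (_ : Fact q.Prime), q ∣ N ∧ ¬ q ^ 2 ∣ N ∧
            padicValNat 3 W.tamagawaProduct ≤ padicValNat 3 ((W.baseChange ℚ_[q]).localTamagawaNumber ℤ_[q])) ∧
          (∀ (q' : ℕ) [Fact q'.Prime], q' ∣ N → 3 ∣ (W.baseChange ℚ_[q']).localTamagawaNumber ℤ_[q'] → ¬ q' ^ 2 ∣ N)) ∧
      IsImaginaryQuadratic K ∧ SatisfiesHeegnerHypothesis N K ∧
      (WeierstrassCurve.Affine.Point.map ι.toRatAlgHom) P = heegnerPointComplex Dt H ∧ ¬ IsOfFinAddOrder P ∧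
      Odd (NumberField.discr K) ∧ 3 ∣ N ∧ W.HasIrreducibleModPGaloisRep 3 ∧ W.exists_weilPairing 3 ∧
      padicValNat 3 (AddSubgroup.zmultiples P).index ≤ padicValNat 3 W.tamagawaProduct + padicValNat 3 Dt.c.natAbs) :
    ¬ (∀ (W : WeierstrassCurve ℚ) [W.IsElliptic] [W.IsGloballyMinimal] (N : ℕ) [NeZero N] (K : Type) [Field K]
        [NumberField K] (Dt : ModularParametrizationData W N) (H : HeegnerDatum N (NumberField.discr K)) (ι : K →+* ℂ)
        (P : (W.baseChange K).toAffine.Point), ¬ W.HasCM → Addv W 3 → SubGss W 3 → W.conductorNorm ℤ = N →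
        (∀ z ∈ Dt.L.lattice, ∃ w ∈ periodLattice Dt.f, z = Dt.c * w) →
        ¬ ((∃ (q : ℕ) (_ : Fact q.Prime), q ∣ N ∧ ¬ q ^ 2 ∣ N ∧
              padicValNat 3 W.tamagawaProduct ≤ padicValNat 3 ((W.baseChange ℚ_[q]).localTamagawaNumber ℤ_[q])) ∧
            (∀ (q' : ℕ) [Fact q'.Prime], q' ∣ N → 3 ∣ (W.baseChange ℚ_[q']).localTamagawaNumber ℤ_[q'] → ¬ q' ^ 2 ∣ N)) →
        IsImaginaryQuadratic K → SatisfiesHeegnerHypothesis N K →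
        (WeierstrassCurve.Affine.Point.map ι.toRatAlgHom) P = heegnerPointComplex Dt H → ¬ IsOfFinAddOrder P →
        Odd (NumberField.discr K) →
        ∀ (s' : ℕ), s' ≤ padicValNat 3 W.tamagawaProduct + (padicValNat 3 Dt.c.natAbs + 1) →
        ∀ (n : ℕ) (d : KolyvaginHeegnerData Dt H.β ι n), Squarefree n →
        (∀ ℓ ∈ n.primeFactors, Zhang2014.IsKolyvaginPrime N W K 3 ℓ ∧ s' ≤ Zhang2014.kolyvaginIndex W 3 ℓ) →
        Three.Koly.PDiv d 3 s') := by
  intro hS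
  obtain ⟨W, _, _, N, _, K, _, _, Dt, H, ι, P, hCM, hAddv, hGss, hN, hOpt, hOff, hK, hHN, hP, hPinf, hodd, h3N, hirr,
    hW, hle⟩ := hF
  obtain ⟨d₁⟩ := nonempty_kolyvaginHeegnerData_one_of_darmon36 (h36 _ W K) hK Dt H.β ι H.dvd_sq_sub
  obtain ⟨hP1, hrank⟩ := map_eq_derivedPoint_and_rank_of_frame (hrec _ W K) (hKo _ W K) hK hHN hP hPinf d₁
  have h := hS W N K Dt H ι P hCM hAddv hGss hN hOpt hOff hK hHN hP hPinf hodd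
    (padicValNat 3 W.tamagawaProduct + padicValNat 3 Dt.c.natAbs + 1) (by omega) 1 d₁ squarefree_one
    (fun ℓ hℓ ↦ absurd hℓ (by simp))
  have := (pDiv_one_iff_le_padicValNat_index_of_irreducible hK hHN h3N hirr hW hrank d₁ P hP1 hPinf _).mp h
  omega

end Irreducible

section Sharp

variable {K : Type} [Field K] [NumberField K]

/-- **The registered budget is SHARP ON EVERY ROW, not only row-uniformly** (tightness lemma (b)).
At an onto Σ★″-frame in the rank-one orientation, ASSUME `BSD₃(E) ∧ BSD₃(E^{d_K})` and McCallum's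
Cor. 5.6 at this datum (`h56`: `M_∞ = m ⟹ #Ш(E/K)[3^∞] = 3^{2(M₀ − m)}`, `M₀ = ord₃ [E(K):ℤP]`; the
labelled hypothesis of the tree's `indexLowerBoundAt_of_kolyvaginCertificate`). THEN the row's
«budget + 1» conclusion — `3^{s'} ∣ P_n` for all `s' ≤ ord₃∏c_ℓ + v₃|c| + 1` and all `n ∈ S(s')` — is
FALSE. Proof: the `n = 1` certificate `3^{M₀+1} ∤ P_1` (McCallum 5.1, unconditional) gives
`M_∞ ≤ M₀ < ∞`; «budget + 1» kills every certificate of level `≤ budget + 1`, so `M_∞ ≥ budget + 1`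
(`iInf_lt_iff` on the tree's `Minf`/`Mr`/`divOrd`); `h56` gives `ord₃ #Ш = 2(M₀ − M_∞) ≤ 2(M₀ − budget − 1)`,
while the two BSD₃'s give `ord₃ #Ш = 2(M₀ − budget)` (`indexBounds_of_bsdp_of_partner_bsdp`, both
components) — contradiction. So with `h56` the deeper layers see what `n = 1` cannot (at `n = 1` alone
«budget + 1» HOLDS when `9 ∣ #Ш(E/K)`, `pDiv_one_iff_of_bsdp_pair`): `M_∞ = ord₃∏c_ℓ + v₃|c|` exactly,
Σ★″ asserts `M_∞ ≥` it (BSD-implied, TightData p625182) and NOTHING stronger survives on any row.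
CONDITIONAL on the named facts, the two `BSDp`'s and `h56`; BSD is proved or disproved for no curve.
[cite: McCallumLMS1991, §5 Lemma 5.1, Thm. 5.4, Cor. 5.6 (pp. 303–310)] [cite: GrossZagier1986, V.(2.2)] -/
theorem budget_succ_false_at_row_of_bsdp_pair_of_h56
    (hGZ : ∀ (N : ℕ) [NeZero N] (W : WeierstrassCurve ℚ) (K : Type) [Field K] [NumberField K],
      gross_zagier N W K)
    (hKo : ∀ (N : ℕ) [NeZero N] (W : WeierstrassCurve ℚ) (K : Type) [Field K] [NumberField K],
      kolyvagin N W K)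
    (hGZK : rank_eq_analyticRank_of_analyticRank_le_one) (hmod : hasEntireLFunction_rat)
    (hGZ73 : GrossZagier1986_thm_I_7_3)
    (hrec : ∀ (N : ℕ) [NeZero N] (W : WeierstrassCurve ℚ) (K : Type) [Field K] [NumberField K],
      heegnerPointOfConductor_one_galoisConj N W K)
    (h36 : ∀ (N : ℕ) [NeZero N] (W : WeierstrassCurve ℚ) (K : Type) [Field K] [NumberField K],
      phi_heegnerTau_mem_range_map_singularModuliField N W K)
    (W : WeierstrassCurve ℚ) [W.IsElliptic] [W.IsGloballyMinimal] (N : ℕ) [NeZero N]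
    (Dt : ModularParametrizationData W N) (H : HeegnerDatum N (NumberField.discr K)) (ι : K →+* ℂ)
    (P : (W.baseChange K).toAffine.Point) (Wd : WeierstrassCurve ℚ) [Wd.IsElliptic] [Wd.IsGloballyMinimal]
    (hr : W.analyticRank = 1) (hN : W.conductorNorm ℤ = N) (h3N : 3 ∣ N)
    (hsurj3 : W.HasSurjectiveModNGaloisRep 3) (hK : IsImaginaryQuadratic K)
    (hodd : Odd (NumberField.discr K)) (hHN : SatisfiesHeegnerHypothesis N K)
    (hLt : (W.quadraticTwist (NumberField.discr K : ℚ)).entireLFunction 1 ≠ 0)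
    (hP : WeierstrassCurve.Affine.Point.map ι.toRatAlgHom P = heegnerPointComplex Dt H)
    (hC : ∃ C : VariableChange ℚ, C • W.quadraticTwist (NumberField.discr K : ℚ) = Wd)
    (hBW : BSDp W 3) (hBWd : BSDp Wd 3)
    (h56 : ∀ m : ℕ, Three.Koly.Minf Dt H.β ι 3 = m →
      Nat.card (AddCommGroup.primaryComponent (W.baseChange K).sha 3) =
        3 ^ (2 * (padicValNat 3 (AddSubgroup.zmultiples P).index - m))) :
    ¬ (∀ (s' : ℕ), s' ≤ padicValNat 3 W.tamagawaProduct + (padicValNat 3 Dt.c.natAbs + 1) →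
        ∀ (n : ℕ) (d : KolyvaginHeegnerData Dt H.β ι n), Squarefree n →
        (∀ ℓ ∈ n.primeFactors, Zhang2014.IsKolyvaginPrime N W K 3 ℓ ∧ s' ≤ Zhang2014.kolyvaginIndex W 3 ℓ) →
        Three.Koly.PDiv d 3 s') := by
  haveI : Fact (Nat.Prime 3) := ⟨Nat.prime_three⟩
  have hp2 : (3 : ℕ) ≠ 2 := by decide
  subst hN
  intro hS
  obtain ⟨-, hμ⟩ := X11b.Three.not_dvd_discr_and_not_dvd_torsionOrder_of_heegner hK hHN hp2 h3N
  have hPinf : ¬ IsOfFinAddOrder P :=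
    not_isOfFinAddOrder_of_heegner_of_analyticRank_eq_one W (W.conductorNorm ℤ) K Dt H ι P (hGZ _ W K) hmod hr hK
      hHN hLt hP
  obtain ⟨d₁⟩ := nonempty_kolyvaginHeegnerData_one_of_darmon36 (h36 _ W K) hK Dt H.β ι H.dvd_sq_sub
  obtain ⟨hP1, hrank⟩ := map_eq_derivedPoint_and_rank_of_frame (hrec _ W K) (hKo _ W K) hK hHN hP hPinf d₁
  haveI : Finite (W.baseChange K).sha := (hKo _ W K hK hHN ⟨Dt, H, ι, hP⟩ hPinf).2
  obtain ⟨hlow, hup⟩ := WildKolyvaginUpperAtThreeTight.indexBounds_of_bsdp_of_partner_bsdp hGZ hKo hGZK hmod hGZ73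
    W 3 (W.conductorNorm ℤ) K Dt H ι P Wd hr rfl h3N hK hodd hμ hHN hLt hP hC hp2 hBW hBWd
  unfold SchneiderFree.IndexLowerBoundLeAt at hlow
  unfold SchneiderFree.Upper.IndexUpperBoundLeAt at hup
  set idx := padicValNat 3 (AddSubgroup.zmultiples P).index with hidx
  set B := padicValNat 3 W.tamagawaProduct + padicValNat 3 Dt.c.natAbs with hB
  -- the `n = 1` certificate: `3^{idx+1} ∤ P_1`, so `M_∞ ≤ idx < ∞`
  have hcert1 : ¬ Three.Koly.PDiv d₁ 3 (idx + 1) := by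
    rw [pDiv_one_iff_le_padicValNat_index hK hsurj3 hrank d₁ P hP1 hPinf]
    omega
  have hMle : Three.Koly.Minf Dt H.β ι 3 ≤ idx :=
    Three.Koly.minf_le_of_certificate d₁ 3 (r := 0) ⟨squarefree_one, by simp, fun ℓ hℓ ↦ absurd hℓ (by simp)⟩ hcert1
  obtain ⟨m, hm⟩ : ∃ m : ℕ, Three.Koly.Minf Dt H.β ι 3 = m :=
    Option.ne_none_iff_exists'.mp (by
      intro htop
      rw [htop] at hMle
      exact absurd hMle (by exact_mod_cast WithTop.not_top_le_coe idx))
  have hm_le : m ≤ idx := by rw [hm] at hMle; exact_mod_cast hMle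
  -- «budget + 1» kills every certificate of level `≤ B + 1`, so `M_∞ ≥ B + 1`
  have hmB : B + 1 ≤ m := by
    by_contra hlt
    have hlt' : Three.Koly.Minf Dt H.β ι 3 < ((B + 1 : ℕ) : ℕ∞) := by
      rw [hm]
      exact_mod_cast (by omega : m < B + 1)
    unfold Three.Koly.Minf at hlt'
    obtain ⟨r, hr'⟩ := iInf_lt_iff.mp hlt'
    unfold Three.Koly.Mr at hr'
    obtain ⟨n, hn'⟩ := iInf_lt_iff.mp hr'
    obtain ⟨d, hd'⟩ := iInf_lt_iff.mp hn'
    obtain ⟨⟨M, hdM, hmem⟩, hltM⟩ := iInf_lt_iff.mp hd'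
    rw [hdM] at hltM
    have hMB : M ≤ B := by
      have : M < B + 1 := by exact_mod_cast hltM
      omega
    have hnd : ¬ Three.Koly.PDiv d 3 (M + 1) := fun h ↦ by
      have hle : ((M + 1 : ℕ) : ℕ∞) ≤ Three.Koly.divOrd d 3 :=
        le_iSup₂ (f := fun (M' : ℕ) (_ : Three.Koly.PDiv d 3 M') ↦ (M' : ℕ∞)) (M + 1) h
      rw [hdM] at hle
      exact absurd (by exact_mod_cast hle : M + 1 ≤ M) (by omega)
    exact hnd (hS (M + 1) (by omega) n d hmem.1 fun ℓ hℓ ↦ hmem.2.2 ℓ hℓ)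
  -- `h56`: `ord₃ #Ш = 2 (idx - m)`; BSD₃-pair: `2 idx = ord₃ #Ш + 2 B`
  have hsha : padicValNat 3 (W.baseChange K).shaOrder = 2 * (idx - m) := by
    rw [Three.Koly.padicValNat_shaOrder_eq, h56 m hm, padicValNat.prime_pow]
  omega

end Sharp

end Summit.BirchSwinnertonDyer.BirchSwinnertonDyer.Theorems.LeafSigmaStarDivisibilityAtThreeOptimalOffRowsNegative

end
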